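import Literature.Computability.QuantumComplexity.ForrelationThm25Amplitude
import HarnessLib

/-!
# The controlled-Hadamard gate as an exact Clifford+T word; controlled Hadamard layers

Towards the uniform `BQP^O` machine of Raz–Tal (J. ACM 69 (2022), App. A with §6 and
Claim 8.1: `m` runs of the one-query Forrelation algorithm of Aaronson–Ambainis, STOC 2015,
Prop. 6, followed by a threshold), in H21's model `BQPRel` (uniform families over the
Clifford+T gate set `{H, S, T, CNOT}` with XOR oracle gates, `QuantumCircuit.lean`). The mixing
unitary `V : (u, v) ↦ ((H_N u + v)/√2, (H_N u − v)/√2)` of that algorithm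
(`RazTalForrelation.mixMatrix`) is a Hadamard transform `H^{⊗n}` on the address register
*controlled* by the half-selector qubit, followed by a Hadamard gate on that qubit; so the
circuit needs the controlled-Hadamard gate `CH = |0⟩⟨0| ⊗ 1 + |1⟩⟨1| ⊗ H`, exactly, over
Clifford+T. This file supplies it:

* `mk2 a b c d` — one-qubit matrices by entries, their products (`mk2_mul_mk2`), and the gates
  `H`, `S`, `T`, `Z` in this form; `omega_eq : ω = (1 + i)/√2`, `invSqrt2_eq_omega :
  1/√2 = (ω − ω³)/2` (`ω = e^{iπ/4}`), so that all entries live in `ℚ(ω)`, `ω⁴ = −1`;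
* `G1`, `wireWord a l`, `toMatrix_wireWord` — words of one-qubit Clifford+T gates on one wire
  act as the placement of the product matrix (`G1.wordMat`);
* `pMat = S H T H S†` (`= e^{iπ/8} R_y(π/4)`) and `qMat = S H T† H S† = pMat†` with
  `pMat_mul_qMat : pMat · qMat = 1` and `pMat_mul_pauliZ_mul_qMat : pMat · Z · qMat = H`
  (the conjugation `R_y(π/4) Z R_y(π/4)† = (Z + X)/√2 = H`); the words `pList`, `qList`
  (`T† = S³T`, `S† = S³`) with `wordMat_pList`, `wordMat_qList`;
* `czWord c a = [H_a, CNOT(c,a), H_a]` and `czWord_mulVec_basisState : |z⟩ ↦ (−1)^{z_c z_a}|z⟩`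
  (Nielsen–Chuang 2010, §4.3, Ex. 4.17, p. 240: `CNOT` from one controlled-`Z` and two Hadamards);
* `chWord c a = qList_a ++ czWord c a ++ pList_a` (20 gates) and
  **`chWord_mulVec_basisState`**: `|z⟩ ↦ |z⟩` if `z_c = 0` and `|z⟩ ↦ H_a|z⟩` if `z_c = 1`
  (controlled-`U` by conjugating a controlled gate with one-qubit gates: Nielsen–Chuang 2010, §4.3,
  Fig. 4.6 with Cor. 4.2, p. 241; `H = Ph(0) Rot(π/2) Ph(0) σ_x` is an instance of Barenco et al.
  1995, Lemma 5.5, p. 8 — here realised as `(1 ⊗ A) · ∧₁(Z) · (1 ⊗ A†)` with `A Z A† = H`);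
* `chLayer c as` (one `chWord c a` per `a ∈ as`) and **`chLayer_mulVec_of_control`**: on state
  vectors supported on `z_c = 1` the layer is the Hadamard layer `as.map hOn`, on state vectors
  supported on `z_c = 0` it is the identity (`chLayer_mulVec_of_not_control`).

## References

* M. A. Nielsen, I. L. Chuang, *Quantum Computation and Quantum Information*, CUP 2010, §4.2
  (`S`, `T`, Ex. 4.18 `HZH = X`), §4.3 (controlled operations: Cor. 4.2 and Fig. 4.6, p. 241;
  Ex. 4.17, p. 240: `CNOT` from controlled-`Z` and two Hadamards), §1.3.1.
* A. Barenco, C. H. Bennett, R. Cleve, D. P. DiVincenzo, N. Margolus, P. Shor, T. Sleator,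
  J. A. Smolin, H. Weinfurter, *Elementary gates for quantum computation*, Phys. Rev. A 52
  (1995) 3457–3467, §5, Lemma 5.5 (p. 8 of quant-ph/9503016: `∧₁(V) = A · ∧₁(σ_x) · B` iff
  `V = Ph(α) Rot(θ) Ph(α) σ_x`; `H` is the case `α = 0`, `θ = π/2`) [BarencoEtAl1995].
* S. Aaronson, A. Ambainis, *Forrelation*, STOC 2015 / SIAM J. Comput. 47 (2018), Prop. 6;
  R. Raz, A. Tal, J. ACM 69 (2022), §6 and App. A [RazTalJACM2022].

## Design notes

* All identities are exact over `ℚ(ω)`: after substituting `i = ω²` and `1/√2 = (ω − ω³)/2`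
  every entry identity is a polynomial identity modulo `ω⁴ = −1`, discharged by `ring_nf` and
  the reductions `omega_pow_four … omega_pow_seven`; products of words are computed one gate at
  a time (`G1.wordMat_append_singleton`) so that degrees stay below `8`.
* Statements are for an arbitrary oracle `A` (`QGate.toMatrix A`); all gates are oracle-free.
-/

noncomputable section

namespace Literature.Computability.QuantumComplexity

open _root_.Computability Complexity Cryptography Matrix

variable {N : ℕ}

/-! ### One-qubit matrices by entries -/

/-- A one-qubit matrix from its four entries: row `|0⟩` is `(a, b)`, row `|1⟩` is `(c, d)`
(columns `|0⟩`, `|1⟩`), i.e. `a = ⟨0|M|0⟩`, `b = ⟨0|M|1⟩`, `c = ⟨1|M|0⟩`, `d = ⟨1|M|1⟩`.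
[Nielsen–Chuang 2010, §2.1.4] [folklore] -/
def mk2 (a b c d : ℂ) : Matrix (QReg 1) (QReg 1) ℂ :=
  Matrix.of fun x y => if x 0 then (if y 0 then d else c) else (if y 0 then b else a)

/-- Entries of `mk2` (definitional). [folklore] -/
theorem mk2_apply (a b c d : ℂ) (x y : QReg 1) :
    mk2 a b c d x y = if x 0 then (if y 0 then d else c) else (if y 0 then b else a) := rfl

/-- Two labels of `QReg 1` are equal iff their bits are. [folklore] -/
theorem qReg_one_eq_iff (x y : QReg 1) : x = y ↔ x 0 = y 0 :=
  ⟨fun h => by rw [h], fun h => funext fun k => by rw [Subsingleton.elim k 0, h]⟩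

/-- **Matrix product by entries.** [Nielsen–Chuang 2010, §2.1.4] [folklore] -/
theorem mk2_mul_mk2 (a b c d a' b' c' d' : ℂ) :
    mk2 a b c d * mk2 a' b' c' d' =
      mk2 (a * a' + b * c') (a * b' + b * d') (c * a' + d * c') (c * b' + d * d') := by
  ext x y
  rw [Matrix.mul_apply, sum_qReg_one, Fintype.sum_bool]
  simp only [mk2_apply]
  rcases Bool.eq_false_or_eq_true (x 0) with hx | hx <;>
  rcases Bool.eq_false_or_eq_true (y 0) with hy | hy <;> simp [hx, hy] <;> ring

/-- The identity by entries. [folklore] -/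
theorem one_eq_mk2 : (1 : Matrix (QReg 1) (QReg 1) ℂ) = mk2 1 0 0 1 := by
  ext x y
  rw [Matrix.one_apply, mk2_apply]
  rcases Bool.eq_false_or_eq_true (x 0) with hx | hx <;>
  rcases Bool.eq_false_or_eq_true (y 0) with hy | hy <;> simp [qReg_one_eq_iff, hx, hy]

/-- The Hadamard gate by entries: `(1/√2) [[1, 1], [1, −1]]`. [Nielsen–Chuang 2010, §1.3.1]
[cite: NielsenChuang2010, §1.3.1] -/
theorem hGate_eq_mk2 : hGate = mk2 invSqrt2 invSqrt2 invSqrt2 (-invSqrt2) := by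
  ext x y
  rw [mk2_apply]
  rcases Bool.eq_false_or_eq_true (x 0) with hx | hx <;>
  rcases Bool.eq_false_or_eq_true (y 0) with hy | hy <;> simp [hGate, invSqrt2, hx, hy]

/-- The phase gate by entries: `diag(1, i)`. [Nielsen–Chuang 2010, §4.2] [cite: NielsenChuang2010, §4.2] -/
theorem sGate_eq_mk2 : sGate = mk2 1 0 0 Complex.I := by
  ext x y
  rw [mk2_apply]
  rcases Bool.eq_false_or_eq_true (x 0) with hx | hx <;>
  rcases Bool.eq_false_or_eq_true (y 0) with hy | hy <;> simp [sGate, qReg_one_eq_iff, hx, hy]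

/-- The `π/8` gate by entries: `diag(1, ω)`. [Nielsen–Chuang 2010, §4.2] [cite: NielsenChuang2010, §4.2] -/
theorem tGate_eq_mk2 : tGate = mk2 1 0 0 omega := by
  ext x y
  rw [mk2_apply]
  rcases Bool.eq_false_or_eq_true (x 0) with hx | hx <;>
  rcases Bool.eq_false_or_eq_true (y 0) with hy | hy <;> simp [tGate, qReg_one_eq_iff, hx, hy]

/-- The Pauli `Z` gate by entries: `diag(1, −1)`. [Nielsen–Chuang 2010, §1.3.1] [cite: NielsenChuang2010, §1.3.1] -/
theorem pauliZ_eq_mk2 : pauliZ = mk2 1 0 0 (-1) := by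
  ext x y
  rw [mk2_apply]
  rcases Bool.eq_false_or_eq_true (x 0) with hx | hx <;>
  rcases Bool.eq_false_or_eq_true (y 0) with hy | hy <;> simp [pauliZ, qReg_one_eq_iff, hx, hy]

/-- A placed one-qubit gate given by entries maps `|w⟩` to `M_{0,wᵢ}|w[i↦0]⟩ + M_{1,wᵢ}|w[i↦1]⟩`.
[Nielsen–Chuang 2010, §4.2] [folklore] -/
theorem placeGate_mk2_mulVec_basisState (i : Fin N) (a b c d : ℂ) (w : QReg N) :
    placeGate (wireEmb i) (mk2 a b c d) *ᵥ basisState w =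
      (if w i then b else a) • basisState (Function.update w i false) +
        (if w i then d else c) • basisState (Function.update w i true) := by
  rw [placeGate_wireEmb_mulVec_basisState]
  rfl

/-! ### The eighth root of unity and `1/√2` -/

/-- `ω = e^{iπ/4} = (1 + i)/√2`. [Nielsen–Chuang 2010, §4.2] [folklore] -/
theorem omega_eq : omega = invSqrt2 * (1 + Complex.I) := by
  have h : omega = Complex.exp (((Real.pi / 4 : ℝ) : ℂ) * Complex.I) := by
    simp only [omega]; push_cast; ring_nf
  rw [h, Complex.exp_mul_I, ← Complex.ofReal_cos, ← Complex.ofReal_sin, Real.cos_pi_div_four,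
    Real.sin_pi_div_four]
  have hs : ((Real.sqrt 2 / 2 : ℝ) : ℂ) = invSqrt2 := by
    simp only [invSqrt2]
    have h2 : ((Real.sqrt 2 : ℝ) : ℂ) ≠ 0 := by
      exact_mod_cast (Real.sqrt_ne_zero'.2 (by norm_num : (0:ℝ) < 2))
    have h3 : ((Real.sqrt 2 : ℝ) : ℂ) * ((Real.sqrt 2 : ℝ) : ℂ) = 2 := by
      rw [← sq, sqrt2_sq]
    push_cast
    field_simp
    rw [sq, h3]
  rw [hs]; ring

/-- `1/√2 = (ω − ω³)/2` (`ω + ω̄ = 2 cos(π/4) = √2`, `ω̄ = −ω³`). [folklore] -/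
theorem invSqrt2_eq_omega : (invSqrt2 : ℂ) = (omega - omega ^ 3) / 2 := by
  rw [omega_eq]
  have hs : (invSqrt2 : ℂ) ^ 2 = 1 / 2 := by rw [sq, invSqrt2_mul_invSqrt2]
  generalize (invSqrt2 : ℂ) = s at hs ⊢
  have hs3 : s ^ 3 = s / 2 := by rw [pow_succ, hs]; ring
  have hI3 : Complex.I ^ 3 = -Complex.I := by rw [pow_succ, Complex.I_sq]; ring
  ring_nf
  rw [Complex.I_sq, hI3, hs3]
  ring

/-- `i = ω²`. [folklore] -/
theorem complexI_eq_omega_sq : Complex.I = omega ^ 2 := omega_pow_two.symm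

/-- `ω⁵ = −ω`. [folklore] -/
theorem omega_pow_five : omega ^ 5 = -omega := by
  rw [show (5 : ℕ) = 4 + 1 from rfl, pow_add, omega_pow_four]; ring

/-- `ω⁶ = −ω²`. [folklore] -/
theorem omega_pow_six : omega ^ 6 = -omega ^ 2 := by
  rw [show (6 : ℕ) = 4 + 2 from rfl, pow_add, omega_pow_four]; ring

/-- `ω⁷ = −ω³`. [folklore] -/
theorem omega_pow_seven : omega ^ 7 = -omega ^ 3 := by
  rw [show (7 : ℕ) = 4 + 3 from rfl, pow_add, omega_pow_four]; ring

/-! ### Words of one-qubit gates on a single wire -/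

/-- The one-qubit gate symbols of Clifford+T. [Nielsen–Chuang 2010, §4.2] [folklore] -/
inductive G1
  | H
  | S
  | T
  deriving DecidableEq

namespace G1

/-- The placed gate of a symbol on wire `a`. [folklore] -/
def gate (a : Fin N) : G1 → QGate cliffordT N
  | H => hOn a
  | S => sOn a
  | T => tOn a

/-- The matrix of a symbol. [folklore] -/
def mat : G1 → Matrix (QReg 1) (QReg 1) ℂ
  | H => hGate
  | S => sGate
  | T => tGate

/-- The matrix of a word (head of the list acts first, so it is the rightmost factor). [folklore] -/
def wordMat : List G1 → Matrix (QReg 1) (QReg 1) ℂ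
  | [] => 1
  | g :: l => wordMat l * g.mat

/-- The placed gate of a symbol is the placement of its matrix. [folklore] -/
theorem toMatrix_gate (A : Language Bool) (a : Fin N) (g : G1) :
    (g.gate a).toMatrix A = placeGate (wireEmb a) g.mat := by
  cases g <;> rfl

/-- Placed symbols are oracle-free. [folklore] -/
theorem gate_isOracleFree (a : Fin N) (g : G1) : (g.gate a).IsOracleFree := by
  cases g <;> trivial

/-- Appending one symbol multiplies on the left. [folklore] -/
theorem wordMat_append_singleton (l : List G1) (g : G1) :
    wordMat (l ++ [g]) = g.mat * wordMat l := by
  induction l with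
  | nil => simp [wordMat]
  | cons g' l ih => rw [List.cons_append, wordMat, ih, wordMat, Matrix.mul_assoc]

end G1

/-- The word of one-qubit gates `l` placed on wire `a`. [folklore] -/
def wireWord (a : Fin N) (l : List G1) : List (QGate cliffordT N) := l.map (G1.gate a)

/-- Words on one wire are oracle-free. [folklore] -/
theorem wireWord_isOracleFree (a : Fin N) (l : List G1) : ∀ g ∈ wireWord a l, g.IsOracleFree := by
  intro g hg
  obtain ⟨s, -, rfl⟩ := List.mem_map.1 hg
  exact G1.gate_isOracleFree a s

/-- **A word on one wire acts as the placement of its product matrix.**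
[Nielsen–Chuang 2010, §4.2] [cite: NielsenChuang2010, §4.2] -/
theorem toMatrix_wireWord (A : Language Bool) (a : Fin N) (l : List G1) :
    (⟨wireWord a l⟩ : QCircuit cliffordT N).toMatrix A = placeGate (wireEmb a) (G1.wordMat l) := by
  induction l with
  | nil => simp [wireWord, G1.wordMat]
  | cons g l ih =>
    change (⟨G1.gate a g :: wireWord a l⟩ : QCircuit cliffordT N).toMatrix A = _
    rw [QCircuit.toMatrix_cons, ih, G1.toMatrix_gate, G1.wordMat, placeGate_mul_holds]

section OmegaAlgebra

/-! ### The matrices `A = S H T H S†` and `A† = S H T† H S†` -/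

/-- `A = S H T H S† = e^{iπ/8} R_y(π/4)`, by entries:
`(1/2) [[1 + ω, −ω² + ω³], [ω² − ω³, 1 + ω]]`. [Nielsen–Chuang 2010, §4.2–4.3]
[cite: NielsenChuang2010, §4.3 (Cor. 4.2 and Fig. 4.6)] -/
def pMat : Matrix (QReg 1) (QReg 1) ℂ :=
  mk2 ((1 + omega) / 2) ((-omega ^ 2 + omega ^ 3) / 2) ((omega ^ 2 - omega ^ 3) / 2) ((1 + omega) / 2)

/-- `A† = S H T† H S†`, by entries: `(1/2) [[1 − ω³, ω − ω²], [−ω + ω², 1 − ω³]]`.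
[Nielsen–Chuang 2010, §4.2–4.3] [cite: NielsenChuang2010, §4.3 (Cor. 4.2 and Fig. 4.6)] -/
def qMat : Matrix (QReg 1) (QReg 1) ℂ :=
  mk2 ((1 - omega ^ 3) / 2) ((omega - omega ^ 2) / 2) ((-omega + omega ^ 2) / 2) ((1 - omega ^ 3) / 2)

/-- `A · A† = 1`. [folklore] -/
theorem pMat_mul_qMat : pMat * qMat = 1 := by
  rw [pMat, qMat, mk2_mul_mk2, one_eq_mk2]
  congr 1 <;>
    (ring_nf ; simp only [omega_pow_four, omega_pow_five, omega_pow_six] ; ring_nf)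

/-- **`A Z A† = H`**: conjugating `Z` by `R_y(π/4)` rotates it to `(Z + X)/√2 = H`.
[Nielsen–Chuang 2010, §4.3, Cor. 4.2 and Fig. 4.6; Barenco et al. 1995, Lemma 5.5]
[cite: NielsenChuang2010, §4.3 (Cor. 4.2 and Fig. 4.6)] -/
theorem pMat_mul_pauliZ_mul_qMat : pMat * pauliZ * qMat = hGate := by
  rw [pMat, qMat, pauliZ_eq_mk2, hGate_eq_mk2, mk2_mul_mk2, mk2_mul_mk2, invSqrt2_eq_omega]
  congr 1 <;>
    (ring_nf ; simp only [omega_pow_four, omega_pow_five, omega_pow_six] ; ring_nf)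

/-- The Clifford+T word for `A = S H T H S†` (time order `S†, H, T, H, S` with `S† = S³`).
[Nielsen–Chuang 2010, §4.2] [cite: NielsenChuang2010, §4.2] -/
def pList : List G1 := [.S, .S, .S, .H, .T, .H, .S]

/-- The Clifford+T word for `A† = S H T† H S†` (time order `S†, H, T†, H, S` with `S† = S³`,
`T† = S³ T`). [Nielsen–Chuang 2010, §4.2] [cite: NielsenChuang2010, §4.2] -/
def qList : List G1 := [.S, .S, .S, .H, .S, .S, .S, .T, .H, .S]

/-- `S³ = diag(1, −ω²)`. [folklore] -/
theorem wordMat_sss : G1.wordMat [.S, .S, .S] = mk2 1 0 0 (-omega ^ 2) := by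
  simp only [G1.wordMat, G1.mat, sGate_eq_mk2, one_eq_mk2, mk2_mul_mk2, complexI_eq_omega_sq]
  congr 1 <;>
    (ring_nf <;> simp only [omega_pow_six])

/-- `H S³`. [folklore] -/
theorem wordMat_sssh : G1.wordMat [.S, .S, .S, .H] =
    mk2 ((omega - omega ^ 3) / 2) ((-omega - omega ^ 3) / 2) ((omega - omega ^ 3) / 2) ((omega + omega ^ 3) / 2) := by
  rw [show [G1.S, .S, .S, .H] = [G1.S, .S, .S] ++ [.H] from rfl, G1.wordMat_append_singleton, wordMat_sss,
    G1.mat, hGate_eq_mk2, invSqrt2_eq_omega, mk2_mul_mk2]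
  congr 1 <;>
    (ring_nf <;> simp only [omega_pow_five] <;> ring_nf)

/-- **The word `pList` multiplies to `A`.** [Nielsen–Chuang 2010, §4.3 (Cor. 4.2, Fig. 4.6)] [cite: NielsenChuang2010, §4.3 (Cor. 4.2 and Fig. 4.6)] -/
theorem wordMat_pList : G1.wordMat pList = pMat := by
  have e5 : G1.wordMat [.S, .S, .S, .H, .T] =
      mk2 ((omega - omega ^ 3) / 2) ((-omega - omega ^ 3) / 2) ((1 + omega ^ 2) / 2) ((-1 + omega ^ 2) / 2) := by
    rw [show [G1.S, .S, .S, .H, .T] = [G1.S, .S, .S, .H] ++ [.T] from rfl, G1.wordMat_append_singleton,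
      wordMat_sssh, G1.mat, tGate_eq_mk2, mk2_mul_mk2]
    congr 1 <;>
      (ring_nf <;> simp only [omega_pow_four] <;> ring_nf)
  have e6 : G1.wordMat [.S, .S, .S, .H, .T, .H] =
      mk2 ((1 + omega) / 2) ((-omega ^ 2 + omega ^ 3) / 2) ((1 - omega) / 2) ((-omega ^ 2 - omega ^ 3) / 2) := by
    rw [show [G1.S, .S, .S, .H, .T, .H] = [G1.S, .S, .S, .H, .T] ++ [.H] from rfl, G1.wordMat_append_singleton,
      e5, G1.mat, hGate_eq_mk2, invSqrt2_eq_omega, mk2_mul_mk2]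
    congr 1 <;>
      (ring_nf ; simp only [omega_pow_four, omega_pow_five, omega_pow_six] ; ring_nf)
  rw [pList, show [G1.S, .S, .S, .H, .T, .H, .S] = [G1.S, .S, .S, .H, .T, .H] ++ [.S] from rfl,
    G1.wordMat_append_singleton, e6, G1.mat, sGate_eq_mk2, complexI_eq_omega_sq, mk2_mul_mk2, pMat]
  congr 1 <;>
    (ring_nf <;> simp only [omega_pow_four, omega_pow_five] <;> ring_nf)

/-- **The word `qList` multiplies to `A†`.** [Nielsen–Chuang 2010, §4.3 (Cor. 4.2, Fig. 4.6)] [cite: NielsenChuang2010, §4.3 (Cor. 4.2 and Fig. 4.6)] -/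
theorem wordMat_qList : G1.wordMat qList = qMat := by
  have e5 : G1.wordMat [.S, .S, .S, .H, .S] =
      mk2 ((omega - omega ^ 3) / 2) ((-omega - omega ^ 3) / 2) ((omega + omega ^ 3) / 2) ((-omega + omega ^ 3) / 2) := by
    rw [show [G1.S, .S, .S, .H, .S] = [G1.S, .S, .S, .H] ++ [.S] from rfl, G1.wordMat_append_singleton,
      wordMat_sssh, G1.mat, sGate_eq_mk2, complexI_eq_omega_sq, mk2_mul_mk2]
    congr 1 <;>
      (ring_nf <;> simp only [omega_pow_five] <;> ring_nf)
  have e6 : G1.wordMat [.S, .S, .S, .H, .S, .S] =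
      mk2 ((omega - omega ^ 3) / 2) ((-omega - omega ^ 3) / 2) ((-omega + omega ^ 3) / 2) ((-omega - omega ^ 3) / 2) := by
    rw [show [G1.S, .S, .S, .H, .S, .S] = [G1.S, .S, .S, .H, .S] ++ [.S] from rfl, G1.wordMat_append_singleton,
      e5, G1.mat, sGate_eq_mk2, complexI_eq_omega_sq, mk2_mul_mk2]
    congr 1 <;>
      (ring_nf <;> simp only [omega_pow_five] <;> ring_nf)
  have e7 : G1.wordMat [.S, .S, .S, .H, .S, .S, .S] =
      mk2 ((omega - omega ^ 3) / 2) ((-omega - omega ^ 3) / 2) ((-omega - omega ^ 3) / 2) ((omega - omega ^ 3) / 2) := by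
    rw [show [G1.S, .S, .S, .H, .S, .S, .S] = [G1.S, .S, .S, .H, .S, .S] ++ [.S] from rfl, G1.wordMat_append_singleton,
      e6, G1.mat, sGate_eq_mk2, complexI_eq_omega_sq, mk2_mul_mk2]
    congr 1 <;>
      (ring_nf <;> simp only [omega_pow_five] <;> ring_nf)
  have e8 : G1.wordMat [.S, .S, .S, .H, .S, .S, .S, .T] =
      mk2 ((omega - omega ^ 3) / 2) ((-omega - omega ^ 3) / 2) ((1 - omega ^ 2) / 2) ((1 + omega ^ 2) / 2) := by
    rw [show [G1.S, .S, .S, .H, .S, .S, .S, .T] = [G1.S, .S, .S, .H, .S, .S, .S] ++ [.T] from rfl,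
      G1.wordMat_append_singleton, e7, G1.mat, tGate_eq_mk2, mk2_mul_mk2]
    congr 1 <;>
      (ring_nf <;> simp only [omega_pow_four] <;> ring_nf)
  have e9 : G1.wordMat [.S, .S, .S, .H, .S, .S, .S, .T, .H] =
      mk2 ((1 - omega ^ 3) / 2) ((omega - omega ^ 2) / 2) ((1 + omega ^ 3) / 2) ((-omega - omega ^ 2) / 2) := by
    rw [show [G1.S, .S, .S, .H, .S, .S, .S, .T, .H] = [G1.S, .S, .S, .H, .S, .S, .S, .T] ++ [.H] from rfl,
      G1.wordMat_append_singleton, e8, G1.mat, hGate_eq_mk2, invSqrt2_eq_omega, mk2_mul_mk2]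
    congr 1 <;>
      (ring_nf ; simp only [omega_pow_four, omega_pow_five, omega_pow_six] ; ring_nf)
  rw [qList, show [G1.S, .S, .S, .H, .S, .S, .S, .T, .H, .S] = [G1.S, .S, .S, .H, .S, .S, .S, .T, .H] ++ [.S] from rfl,
    G1.wordMat_append_singleton, e9, G1.mat, sGate_eq_mk2, complexI_eq_omega_sq, mk2_mul_mk2, qMat]
  congr 1 <;>
    (ring_nf <;> simp only [omega_pow_four, omega_pow_five] <;> ring_nf)

end OmegaAlgebra

/-! ### The controlled-`Z` word `H_a · CNOT(c, a) · H_a` -/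

/-- The word `[H_a, CNOT(c → a), H_a]` for the controlled-`Z` gate on control `c` and target `a`.
[Nielsen–Chuang 2010, §4.3, Ex. 4.17] [cite: NielsenChuang2010, §4.3 Ex. 4.17 (p. 240)] -/
def czWord (c a : Fin N) (h : c ≠ a) : List (QGate cliffordT N) :=
  [hOn a, cnotOn c a h, hOn a]

/-- `czWord` is oracle-free. [folklore] -/
theorem czWord_isOracleFree (c a : Fin N) (h : c ≠ a) : ∀ g ∈ czWord c a h, g.IsOracleFree := by
  intro g hg
  simp only [czWord, List.mem_cons, List.not_mem_nil, or_false] at hg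
  rcases hg with rfl | rfl | rfl <;> trivial

/-- **The controlled-`Z` word on basis states**: `|z⟩ ↦ (−1)^{z_c z_a} |z⟩`.
[Nielsen–Chuang 2010, §4.3, Ex. 4.17] [cite: NielsenChuang2010, §4.3 Ex. 4.17 (p. 240)] -/
theorem czWord_mulVec_basisState (A : Language Bool) (c a : Fin N) (h : c ≠ a) (z : QReg N) :
    (⟨czWord c a h⟩ : QCircuit cliffordT N).toMatrix A *ᵥ basisState z =
      (if z c && z a then (-1 : ℂ) else 1) • basisState z := by
  rw [czWord, show [hOn a, cnotOn c a h, hOn a] = hOn a :: ([cnotOn c a h] ++ [hOn a]) from rfl,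
    hSandwich_mulVec, QCircuit.toMatrix_cons, QCircuit.toMatrix_nil, Matrix.one_mul]
  set z0 := Function.update z a false with hz0
  set z1 := Function.update z a true with hz1
  set σ : ℂ := if z a then (-1 : ℂ) else 1 with hσ
  have hback : (hOn a).toMatrix A *ᵥ ((hOn a).toMatrix A *ᵥ basisState z) = basisState z := by
    rw [Matrix.mulVec_mulVec, hOn_mul_hOn, Matrix.one_mulVec]
  have hHz : (hOn a).toMatrix A *ᵥ basisState z = invSqrt2 • (basisState z0 + σ • basisState z1) :=
    hOn_mulVec_basisState' A a z
  have h0c : z0 c = z c := by rw [hz0, Function.update_of_ne h]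
  have h1c : z1 c = z c := by rw [hz1, Function.update_of_ne h]
  have h0a : z0 a = false := by rw [hz0, Function.update_self]
  have h1a : z1 a = true := by rw [hz1, Function.update_self]
  have hu00 : Function.update z0 a false = z0 := by simp [hz0]
  have hu01 : Function.update z0 a true = z1 := by simp [hz0, hz1]
  have hu10 : Function.update z1 a false = z0 := by simp [hz0, hz1]
  have hu11 : Function.update z1 a true = z1 := by simp [hz1]
  have hC0 : (cnotOn c a h).toMatrix A *ᵥ basisState z0 = basisState (if z c then z1 else z0) := by
    rw [cnotOn_mulVec_basisState, h0a, h0c, Bool.false_xor]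
    cases z c
    · rw [hu00]; rfl
    · rw [hu01]; rfl
  have hC1 : (cnotOn c a h).toMatrix A *ᵥ basisState z1 = basisState (if z c then z0 else z1) := by
    rw [cnotOn_mulVec_basisState, h1a, h1c, Bool.true_xor]
    cases z c
    · rw [Bool.not_false, hu11]; rfl
    · rw [Bool.not_true, hu10]; rfl
  rw [hHz, Matrix.mulVec_smul ((cnotOn c a h).toMatrix A), Matrix.mulVec_add,
    Matrix.mulVec_smul ((cnotOn c a h).toMatrix A), hC0, hC1]
  cases hc : z c
  · -- control off: `CNOT` is the identity on both branches
    simp only [Bool.false_eq_true, ↓reduceIte, Bool.false_and, one_smul]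
    rw [← hHz, hback]
  · -- control on: `CNOT` swaps the two branches, which multiplies `H_a|z⟩` by `σ = (−1)^{z_a}`
    simp only [↓reduceIte, Bool.true_and]
    have hσ2 : σ * σ = 1 := by rw [hσ]; split_ifs <;> norm_num
    have key : invSqrt2 • (basisState z1 + σ • basisState z0) =
        σ • (invSqrt2 • (basisState z0 + σ • basisState z1)) := by
      rw [smul_comm σ invSqrt2, smul_add σ, smul_smul, hσ2, one_smul, add_comm]
    rw [key, ← hHz, Matrix.mulVec_smul, hback, hσ]

/-! ### The controlled-Hadamard word -/

/-- **The Clifford+T word for the controlled-Hadamard gate** with control `c` and target `a`: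
`A†` on `a` (word `qList`), the controlled-`Z` word, `A` on `a` (word `pList`) — 20 gates.
[Nielsen–Chuang 2010, §4.3, Fig. 4.6 with Cor. 4.2; Barenco et al. 1995, Lemma 5.5]
[cite: NielsenChuang2010, §4.3 Fig. 4.6 with Cor. 4.2 (p. 241)] [cite: BarencoEtAl1995, Lemma 5.5 (p. 8)] -/
def chWord (c a : Fin N) (h : c ≠ a) : List (QGate cliffordT N) :=
  wireWord a qList ++ (czWord c a h ++ wireWord a pList)

/-- `chWord` is oracle-free. [folklore] -/
theorem chWord_isOracleFree (c a : Fin N) (h : c ≠ a) : ∀ g ∈ chWord c a h, g.IsOracleFree := by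
  intro g hg
  simp only [chWord, List.mem_append] at hg
  rcases hg with hg | hg | hg
  · exact wireWord_isOracleFree a qList g hg
  · exact czWord_isOracleFree c a h g hg
  · exact wireWord_isOracleFree a pList g hg

/-- The controlled-Hadamard word has `20` gates. [folklore] -/
theorem length_chWord (c a : Fin N) (h : c ≠ a) : (chWord c a h).length = 20 := rfl

/-- **The controlled-Hadamard word on basis states**: the identity if the control bit is `0`,
the Hadamard gate on the target if the control bit is `1` (`A A† = 1`, `A Z A† = H`).
[Nielsen–Chuang 2010, §4.3, Fig. 4.6 with Cor. 4.2; Barenco et al. 1995, Lemma 5.5]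
[cite: NielsenChuang2010, §4.3 Fig. 4.6 with Cor. 4.2 (p. 241)] [cite: BarencoEtAl1995, Lemma 5.5 (p. 8)] -/
theorem chWord_mulVec_basisState (A : Language Bool) (c a : Fin N) (h : c ≠ a) (z : QReg N) :
    (⟨chWord c a h⟩ : QCircuit cliffordT N).toMatrix A *ᵥ basisState z =
      if z c then (hOn a).toMatrix A *ᵥ basisState z else basisState z := by
  rw [chWord, show (⟨wireWord a qList ++ (czWord c a h ++ wireWord a pList)⟩ : QCircuit cliffordT N) =
      (⟨wireWord a qList⟩ : QCircuit cliffordT N).append ((⟨czWord c a h⟩ : QCircuit cliffordT N).append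
        ⟨wireWord a pList⟩) from rfl,
    QCircuit.toMatrix_append, QCircuit.toMatrix_append, toMatrix_wireWord, toMatrix_wireWord, wordMat_qList,
    wordMat_pList, ← Matrix.mulVec_mulVec, ← Matrix.mulVec_mulVec]
  set z0 := Function.update z a false with hz0
  set z1 := Function.update z a true with hz1
  have h0c : z0 c = z c := by rw [hz0, Function.update_of_ne h]
  have h1c : z1 c = z c := by rw [hz1, Function.update_of_ne h]
  have h0a : z0 a = false := by rw [hz0, Function.update_self]
  have h1a : z1 a = true := by rw [hz1, Function.update_self]
  -- `A†|z⟩ = q₀|z[a↦0]⟩ + q₁|z[a↦1]⟩`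
  set q₀ : ℂ := if z a then (omega - omega ^ 2) / 2 else (1 - omega ^ 3) / 2 with hq₀
  set q₁ : ℂ := if z a then (1 - omega ^ 3) / 2 else (-omega + omega ^ 2) / 2 with hq₁
  have hQ : placeGate (wireEmb a) qMat *ᵥ basisState z = q₀ • basisState z0 + q₁ • basisState z1 := by
    rw [qMat, placeGate_mk2_mulVec_basisState]
  have hCZ0 : (⟨czWord c a h⟩ : QCircuit cliffordT N).toMatrix A *ᵥ basisState z0 = basisState z0 := by
    rw [czWord_mulVec_basisState, h0a, Bool.and_false]; simp
  have hCZ1 : (⟨czWord c a h⟩ : QCircuit cliffordT N).toMatrix A *ᵥ basisState z1 =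
      (if z c then (-1 : ℂ) else 1) • basisState z1 := by
    rw [czWord_mulVec_basisState, h1a, h1c, Bool.and_true]
  rw [hQ, Matrix.mulVec_add, Matrix.mulVec_smul, Matrix.mulVec_smul, hCZ0, hCZ1]
  cases hc : z c
  · -- control off: `CZ` trivial, `A A† = 1`
    simp only [Bool.false_eq_true, ↓reduceIte, one_smul]
    rw [← hQ, Matrix.mulVec_mulVec, ← placeGate_mul_holds, pMat_mul_qMat, placeGate_one, Matrix.one_mulVec]
  · -- control on: `CZ` acts as `Z_a`, `A Z A† = H`
    simp only [↓reduceIte]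
    have e1 : q₀ • basisState z0 + q₁ • ((-1 : ℂ) • basisState z1) =
        placeGate (wireEmb a) (pauliZ * qMat) *ᵥ basisState z := by
      rw [qMat, pauliZ_eq_mk2, mk2_mul_mk2, placeGate_mk2_mulVec_basisState, ← hz0, ← hz1, hq₀, hq₁, smul_smul]
      rcases Bool.eq_false_or_eq_true (z a) with ha | ha <;> simp [ha]
    rw [e1, Matrix.mulVec_mulVec, ← placeGate_mul_holds, ← Matrix.mul_assoc, pMat_mul_pauliZ_mul_qMat,
      hOn_toMatrix]

/-! ### Controlled Hadamard layers -/

/-- One controlled-Hadamard word per target wire of `as`, all with control `c ∉ as`.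
[Nielsen–Chuang 2010, §4.3] [cite: NielsenChuang2010, §4.3] -/
def chLayer (c : Fin N) : (as : List (Fin N)) → (∀ a ∈ as, c ≠ a) → List (QGate cliffordT N)
  | [], _ => []
  | a :: as, h => chWord c a (h a (by simp)) ++ chLayer c as (fun a' ha' => h a' (by simp [ha']))

/-- `chLayer` is oracle-free. [folklore] -/
theorem chLayer_isOracleFree (c : Fin N) : ∀ (as : List (Fin N)) (h : ∀ a ∈ as, c ≠ a),
    ∀ g ∈ chLayer c as h, g.IsOracleFree
  | [], _, g, hg => by simp [chLayer] at hg
  | a :: as, h, g, hg => by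
    simp only [chLayer, List.mem_append] at hg
    rcases hg with hg | hg
    · exact chWord_isOracleFree c a _ g hg
    · exact chLayer_isOracleFree c as _ g hg

/-- The controlled layer has `20` gates per target. [folklore] -/
theorem length_chLayer (c : Fin N) : ∀ (as : List (Fin N)) (h : ∀ a ∈ as, c ≠ a),
    (chLayer c as h).length = 20 * as.length
  | [], _ => rfl
  | a :: as, h => by
    rw [chLayer, List.length_append, length_chLayer c as, length_chWord, List.length_cons]; ring

/-- A state vector is the superposition of the basis states weighted by its amplitudes. [folklore] -/
theorem eq_sum_smul_basisState (ψ : QReg N → ℂ) : ψ = ∑ z, ψ z • basisState z := by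
  funext x
  simp [Finset.sum_apply, basisState_apply]

/-- **The controlled layer on basis states with control bit `1` is the Hadamard layer.**
[Nielsen–Chuang 2010, §4.3] [cite: NielsenChuang2010, §4.3] -/
theorem chLayer_mulVec_basisState_of_control (A : Language Bool) (c : Fin N) :
    ∀ (as : List (Fin N)) (h : ∀ a ∈ as, c ≠ a) (z : QReg N), z c = true →
      (⟨chLayer c as h⟩ : QCircuit cliffordT N).toMatrix A *ᵥ basisState z =
        (⟨as.map hOn⟩ : QCircuit cliffordT N).toMatrix A *ᵥ basisState z
  | [], _, z, _ => rfl
  | a :: as, h, z, hz => by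
    have hca : c ≠ a := h a (by simp)
    have h' : ∀ a' ∈ as, c ≠ a' := fun a' ha' => h a' (by simp [ha'])
    rw [chLayer, show (⟨chWord c a hca ++ chLayer c as h'⟩ : QCircuit cliffordT N) =
        (⟨chWord c a hca⟩ : QCircuit cliffordT N).append ⟨chLayer c as h'⟩ from rfl,
      QCircuit.toMatrix_append, ← Matrix.mulVec_mulVec, chWord_mulVec_basisState, if_pos hz,
      List.map_cons, QCircuit.toMatrix_cons, ← Matrix.mulVec_mulVec, hOn_mulVec_basisState' A a z,
      Matrix.mulVec_smul, Matrix.mulVec_smul, Matrix.mulVec_add, Matrix.mulVec_add, Matrix.mulVec_smul,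
      Matrix.mulVec_smul,
      chLayer_mulVec_basisState_of_control A c as h' _ (by rw [Function.update_of_ne hca]; exact hz),
      chLayer_mulVec_basisState_of_control A c as h' _ (by rw [Function.update_of_ne hca]; exact hz)]

/-- **The controlled layer on basis states with control bit `0` is the identity.**
[Nielsen–Chuang 2010, §4.3] [cite: NielsenChuang2010, §4.3] -/
theorem chLayer_mulVec_basisState_of_not_control (A : Language Bool) (c : Fin N) :
    ∀ (as : List (Fin N)) (h : ∀ a ∈ as, c ≠ a) (z : QReg N), z c = false →
      (⟨chLayer c as h⟩ : QCircuit cliffordT N).toMatrix A *ᵥ basisState z = basisState z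
  | [], _, z, _ => by simp [chLayer]
  | a :: as, h, z, hz => by
    have hca : c ≠ a := h a (by simp)
    have h' : ∀ a' ∈ as, c ≠ a' := fun a' ha' => h a' (by simp [ha'])
    rw [chLayer, show (⟨chWord c a hca ++ chLayer c as h'⟩ : QCircuit cliffordT N) =
        (⟨chWord c a hca⟩ : QCircuit cliffordT N).append ⟨chLayer c as h'⟩ from rfl,
      QCircuit.toMatrix_append, ← Matrix.mulVec_mulVec, chWord_mulVec_basisState]
    simp only [hz, Bool.false_eq_true, ↓reduceIte]
    exact chLayer_mulVec_basisState_of_not_control A c as h' z hz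

/-- **The controlled Hadamard layer on a state vector supported on control bit `1`** is the
Hadamard layer `∏_{a ∈ as} H_a`. [Nielsen–Chuang 2010, §4.3] [cite: NielsenChuang2010, §4.3] -/
theorem chLayer_mulVec_of_control (A : Language Bool) (c : Fin N) (as : List (Fin N))
    (h : ∀ a ∈ as, c ≠ a) {ψ : QReg N → ℂ} (hψ : ∀ z, z c = false → ψ z = 0) :
    (⟨chLayer c as h⟩ : QCircuit cliffordT N).toMatrix A *ᵥ ψ =
      (⟨as.map hOn⟩ : QCircuit cliffordT N).toMatrix A *ᵥ ψ := by
  conv_lhs => rw [eq_sum_smul_basisState ψ]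
  conv_rhs => rw [eq_sum_smul_basisState ψ]
  rw [Matrix.mulVec_sum, Matrix.mulVec_sum]
  refine Finset.sum_congr rfl fun z _ => ?_
  rw [Matrix.mulVec_smul, Matrix.mulVec_smul]
  cases hz : z c
  · rw [hψ z hz, zero_smul, zero_smul]
  · rw [chLayer_mulVec_basisState_of_control A c as h z hz]

/-- **The controlled Hadamard layer on a state vector supported on control bit `0`** is the
identity. [Nielsen–Chuang 2010, §4.3] [cite: NielsenChuang2010, §4.3] -/
theorem chLayer_mulVec_of_not_control (A : Language Bool) (c : Fin N) (as : List (Fin N))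
    (h : ∀ a ∈ as, c ≠ a) {ψ : QReg N → ℂ} (hψ : ∀ z, z c = true → ψ z = 0) :
    (⟨chLayer c as h⟩ : QCircuit cliffordT N).toMatrix A *ᵥ ψ = ψ := by
  conv_lhs => rw [eq_sum_smul_basisState ψ]
  conv_rhs => rw [eq_sum_smul_basisState ψ]
  rw [Matrix.mulVec_sum]
  refine Finset.sum_congr rfl fun z _ => ?_
  rw [Matrix.mulVec_smul]
  cases hz : z c
  · rw [chLayer_mulVec_basisState_of_not_control A c as h z hz]
  · rw [hψ z hz, zero_smul, zero_smul]

end Literature.Computability.QuantumComplexity
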